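import Literature.AnabelianGeometry.SemiGraphs.CharacteristicOpenCoreProP
import Literature.GroupTheory.ProfiniteConjugateIndex
import HarnessLib

/-!
# Conjugates of a finite family of closed procyclic subgroups of a profinite group: the abstract form of [IUTchI] Rmk. 1.2.3 (iv)/(v)

Mochizuki, *Inter-universal Teichmüller theory I* [IUTchI] Rmk. 1.2.3 (iv), (v) (kurims manuscript pp. 41–43)
characterizes the cuspidal (resp. nodal) edge-like subgroups of the PSC-fundamental group `Π_G` as "the
maximal closed subgroups `A ⊆ Π_G` isomorphic to `ℤ_l` which satisfy the following condition: for every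
characteristic open subgroup `Π_{G'} ⊆ Π_G` … the cyclic finite étale covering `G' → G''`
[`Π_{G''} := A · Π_{G'}`] is cuspidally (resp. nodally) totally ramified", and says of the proof only that
one "verifies immediately" — from [CombGC] Prop. 1.2.  PROOF-ONLY file (abc-iut-w5-d160, D-0079 L-F row
F-1937; no definitions): the GROUP-THEORETIC CORE of that verification, for an arbitrary finite family
`S : ι → Subgroup Π` of closed subgroups of a profinite, topologically finitely generated, pro-`p` group `Π`
and an abstract "ramification" predicate `R` (instantiated to the typed nodal / cuspidal predicates of
abc-iut-L3-t4's `PSCRamification.lean` in the companion `PSCEdgeLikeCharacterizationReduction.lean`).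

* `exists_le_conj_of_forall_characteristic` — the LIMIT STEP of abc-iut-f-164's
  `PSCCuspidalCharacterizationConverse.lean`, for a finite family: if for every characteristic open `U`
  the subgroup `A` lies in `γ_U • S(i_U) · U`, then `A ≤ g • S(i)` for ONE `i` and ONE `g` (finiteness of
  `ι` + stability of characteristic open subgroups under finite meets; compactness of `Π`; cofinality of
  the characteristic open subgroups — Serre's theorem on topologically finitely generated pro-`p` groups,
  the tree's `mem_of_forall_characteristic_mem_sup`);
* `conj_eq_of_conj_le` — if containment between conjugates of members of the family determines the index,
  it forces EQUALITY (`γ•S(i) ≤ δ•S(j) ⇒ γ•S(i) = δ•S(j)`): a closed subgroup of a profinite group contained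
  in a conjugate of itself is that conjugate (`ProfiniteConjugateIndex.conj_smul_eq_self_of_ge`);
* `conj_family_characterization` — for closed, topologically procyclic, infinite `S(i)` with that
  containment property, and `R` such that `R (A·U) U ⇒ A ≤ γ•S(i)·U` for some `i, γ` and `R (γ•S(i)·U) U`
  always: `A` is a conjugate of some `S(i)` **iff** `A` is closed, procyclic, infinite, satisfies
  `R (A·U) U` for every characteristic open `U`, and is maximal among such subgroups.  (`cond` of a
  conjugate is automatic; maximality and the converse both come from the limit step followed by
  `conj_eq_of_conj_le` — no malnormality input.)

Plain profinite group theory; nothing here takes a side on [IUTchIII] Cor. 3.12.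
[cite: Mochizuki2012, IUTchI Rmk 1.2.3(iv)-(v) pp.41-43] [cite: DDMSAnalyticProP1999, Thm 1.17]
-/

noncomputable section

namespace Literature.AnabelianGeometry.SemiGraphs

namespace ConjFamily

open scoped Pointwise
open Literature.AnabelianGeometry.AbsoluteAnabelian (IsTopologicallyFinitelyGenerated)
open Literature.GroupTheory.ProfiniteConjugateIndex (conj_smul_eq_self_of_ge)

universe u

variable {P : Type u} [Group P] [TopologicalSpace P] [IsTopologicalGroup P]

/-! ### Folklore bookkeeping on conjugates -/

omit [TopologicalSpace P] [IsTopologicalGroup P] in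
/-- Membership in a conjugate: `a ∈ γ • S ↔ g⁻¹ a g ∈ S` for `γ = g`. [folklore] -/
private theorem mem_conj_smul_iff₅ {S : Subgroup P} (γ : ConjAct P) (a : P) :
    a ∈ γ • S ↔ (ConjAct.ofConjAct γ)⁻¹ * a * ConjAct.ofConjAct γ ∈ S := by
  rw [Subgroup.mem_pointwise_smul_iff_inv_smul_mem, ConjAct.smul_def, ConjAct.ofConjAct_inv, inv_inv]

omit [TopologicalSpace P] [IsTopologicalGroup P] in
/-- Characteristic subgroups are stable under binary intersection. [folklore] -/
private theorem characteristic_inf₅ {U₁ U₂ : Subgroup P} (h₁ : U₁.Characteristic)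
    (h₂ : U₂.Characteristic) : (U₁ ⊓ U₂).Characteristic :=
  ⟨fun ϕ => by rw [Subgroup.comap_inf, h₁.fixed, h₂.fixed]⟩

omit [TopologicalSpace P] [IsTopologicalGroup P] in
/-- Characteristic subgroups are stable under intersections of families. [folklore] -/
private theorem characteristic_iInf₅ {ι : Type*} {U : ι → Subgroup P}
    (h : ∀ i, (U i).Characteristic) : (⨅ i, U i).Characteristic :=
  ⟨fun ϕ => by
    rw [Subgroup.comap_iInf]
    exact iInf_congr fun i => (h i).fixed ϕ⟩

/-- A conjugate of a closed subgroup is closed. [folklore] -/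
private theorem isClosed_conj_smul₅ {A : Subgroup P} (hA : IsClosed (A : Set P)) (γ : ConjAct P) :
    IsClosed ((γ • A : Subgroup P) : Set P) := by
  have h : ((γ • A : Subgroup P) : Set P) = (fun x : P => γ⁻¹ • x) ⁻¹' (A : Set P) := by
    ext x
    rw [SetLike.mem_coe, Subgroup.mem_pointwise_smul_iff_inv_smul_mem]
    rfl
  rw [h]
  refine hA.preimage ?_
  simp only [ConjAct.smul_def]
  fun_prop

omit [TopologicalSpace P] [IsTopologicalGroup P] in
/-- `γ • ⟨a⟩ = ⟨γ • a⟩`. [folklore] -/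
private theorem smul_zpowers₅ (γ : ConjAct P) (a : P) :
    γ • Subgroup.zpowers a = Subgroup.zpowers (γ • a) := by
  rw [Subgroup.pointwise_smul_def, MonoidHom.map_zpowers]
  rfl

/-- Conjugation carries the closure of `⟨a⟩` to the closure of `⟨γ • a⟩`. [folklore] -/
private theorem smul_topologicalClosure_zpowers₅ (γ : ConjAct P) (a : P) :
    γ • (Subgroup.zpowers a).topologicalClosure = (Subgroup.zpowers (γ • a)).topologicalClosure := by
  have key : ∀ (δ : ConjAct P) (b : P), δ • (Subgroup.zpowers b).topologicalClosure ≤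
      (Subgroup.zpowers (δ • b)).topologicalClosure := by
    intro δ b x hx
    rw [Subgroup.mem_pointwise_smul_iff_inv_smul_mem] at hx
    have hcont : Continuous fun y : P => δ • y := by simp only [ConjAct.smul_def]; fun_prop
    have himg : (fun y : P => δ • y) '' ((Subgroup.zpowers b).topologicalClosure : Set P) ⊆
        ((Subgroup.zpowers (δ • b)).topologicalClosure : Set P) := by
      rw [Subgroup.topologicalClosure_coe, Subgroup.topologicalClosure_coe]
      refine (image_closure_subset_closure_image hcont).trans (closure_mono ?_)
      rintro _ ⟨y, hy, rfl⟩
      rw [SetLike.mem_coe, ← smul_zpowers₅]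
      exact Subgroup.smul_mem_pointwise_smul _ _ _ hy
    exact himg ⟨δ⁻¹ • x, hx, smul_inv_smul δ x⟩
  refine le_antisymm (key γ a) ?_
  have h2 := key γ⁻¹ (γ • a)
  rw [inv_smul_smul] at h2
  intro x hx
  rw [Subgroup.mem_pointwise_smul_iff_inv_smul_mem]
  exact h2 (Subgroup.smul_mem_pointwise_smul _ _ _ hx)

omit [TopologicalSpace P] [IsTopologicalGroup P] in
/-- A conjugate of an infinite subgroup is infinite. [folklore] -/
private theorem infinite_conj_smul₅ {A : Subgroup P} (hA : (A : Set P).Infinite) (γ : ConjAct P) :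
    ((γ • A : Subgroup P) : Set P).Infinite := by
  haveI : Infinite A := Set.infinite_coe_iff.mpr hA
  haveI : Infinite (γ • A : Subgroup P) := Infinite.of_injective _ (Subgroup.equivSMul γ A).injective
  exact Set.infinite_coe_iff.mp ‹Infinite (γ • A : Subgroup P)›

/-! ### The limit step for a finite family of closed subgroups (compactness + Serre) -/

section Family

variable [CompactSpace P] [TotallyDisconnectedSpace P]

/-- **The limit step** (abc-iut-f-164's steps (2)–(4) of `isCuspidal_of_condMaximal_of_forall_cuspidal_cond`,
for an arbitrary finite family `S` of closed subgroups of a profinite, topologically finitely generated,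
pro-`p` group `Π`): if for every characteristic open `U` the subgroup `A` lies in `γ_U • S(i_U) · U` for
some index `i_U` and some `γ_U`, then `A ≤ g • S(i)` for ONE index `i` and ONE `g`.  (One index serves
every `U` since `ι` is finite and characteristic open subgroups are closed under finite meets; one `g`
by compactness of `Π`; then `⋂_U S(i)·U = S(i)` because characteristic open subgroups are cofinal —
Serre's theorem, `mem_of_forall_characteristic_mem_sup`.) [cite: DDMSAnalyticProP1999, Thm 1.17] -/
theorem exists_le_conj_of_forall_characteristic {ι : Type*} [Finite ι] (S : ι → Subgroup P)
    (hS : ∀ i, IsClosed (S i : Set P)) {p : ℕ} [Fact p.Prime]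
    (hP : ∀ U : OpenNormalSubgroup P, IsPGroup p (P ⧸ (U : Subgroup P)))
    (htfg : IsTopologicallyFinitelyGenerated P) {A : Subgroup P}
    (h : ∀ U : Subgroup P, U.Characteristic → IsOpen (U : Set P) →
      ∃ (i : ι) (γ : ConjAct P), A ≤ γ • S i ⊔ U) :
    ∃ (i : ι) (g : ConjAct P), A ≤ g • S i := by
  -- one index `i₀` serves every characteristic open `U`
  have step2 : ∃ i₀ : ι, ∀ U : Subgroup P, U.Characteristic → IsOpen (U : Set P) →
      ∃ γ : ConjAct P, A ≤ γ • S i₀ ⊔ U := by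
    by_contra hno
    push Not at hno
    choose U hUc hUo hbad using hno
    have hU₀c : (⨅ i, U i).Characteristic := characteristic_iInf₅ hUc
    have hU₀o : IsOpen ((⨅ i, U i : Subgroup P) : Set P) := by
      rw [Subgroup.coe_iInf]
      exact isOpen_iInter_of_finite fun i => hUo i
    obtain ⟨i₀, γ, hle⟩ := h _ hU₀c hU₀o
    exact hbad i₀ γ (hle.trans (sup_le_sup_left (iInf_le _ i₀) _))
  obtain ⟨i₀, hi₀⟩ := step2
  -- compactness: one conjugator `g₀` serves every characteristic open `U`
  let J : Type u := {U : Subgroup P // U.Characteristic ∧ IsOpen (U : Set P)}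
  let K : J → Set P := fun U => {x : P | ∀ a ∈ A, x⁻¹ * a * x ∈ S i₀ ⊔ U.1}
  have hKdef : ∀ (U : J) (x : P), x ∈ K U ↔ ∀ a ∈ A, x⁻¹ * a * x ∈ S i₀ ⊔ U.1 :=
    fun _ _ => Iff.rfl
  have hKiff : ∀ (U : J) (γ : ConjAct P),
      A ≤ γ • S i₀ ⊔ U.1 ↔ ConjAct.ofConjAct γ ∈ K U := by
    intro U γ
    haveI : U.1.Characteristic := U.2.1
    have hN : γ • U.1 = U.1 := (inferInstance : U.1.Normal).conjAct γ
    have hconj : γ • (S i₀ ⊔ U.1) = γ • S i₀ ⊔ U.1 := by rw [Subgroup.smul_sup, hN]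
    rw [hKdef, ← hconj]
    exact ⟨fun hle a ha => (mem_conj_smul_iff₅ γ a).mp (hle ha),
      fun hm a ha => (mem_conj_smul_iff₅ γ a).mpr (hm a ha)⟩
  have hKne : ∀ U : J, (K U).Nonempty := fun U => by
    obtain ⟨γ, hγ⟩ := hi₀ U.1 U.2.1 U.2.2
    exact ⟨_, (hKiff U γ).mp hγ⟩
  have hKcl : ∀ U : J, IsClosed (K U) := fun U => by
    have hopen : IsOpen ((S i₀ ⊔ U.1 : Subgroup P) : Set P) :=
      Subgroup.isOpen_mono le_sup_right U.2.2
    have hclosed : IsClosed ((S i₀ ⊔ U.1 : Subgroup P) : Set P) :=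
      Subgroup.isClosed_of_isOpen _ hopen
    have hK : K U = ⋂ a ∈ A,
        (fun x : P => x⁻¹ * a * x) ⁻¹' ((S i₀ ⊔ U.1 : Subgroup P) : Set P) := by
      ext x
      simp only [Set.mem_iInter, Set.mem_preimage, SetLike.mem_coe]
      exact hKdef U x
    rw [hK]
    exact isClosed_biInter fun a _ =>
      hclosed.preimage ((continuous_inv.mul continuous_const).mul continuous_id)
  have hKdir : Directed (· ⊇ ·) K := by
    intro U₁ U₂
    refine ⟨⟨U₁.1 ⊓ U₂.1, characteristic_inf₅ U₁.2.1 U₂.2.1, U₁.2.2.inter U₂.2.2⟩, ?_, ?_⟩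
    · intro x hx a ha
      exact (sup_le_sup_left (inf_le_left : U₁.1 ⊓ U₂.1 ≤ U₁.1) _) (hx a ha)
    · intro x hx a ha
      exact (sup_le_sup_left (inf_le_right : U₁.1 ⊓ U₂.1 ≤ U₂.1) _) (hx a ha)
  haveI : Nonempty J := ⟨⟨⊤, inferInstance, by rw [Subgroup.coe_top]; exact isOpen_univ⟩⟩
  obtain ⟨g₀, hg₀⟩ := IsCompact.nonempty_iInter_of_directed_nonempty_isCompact_isClosed K hKdir hKne
    (fun U => (hKcl U).isCompact) hKcl
  -- Serre: `A ≤ g₀ • S i₀`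
  refine ⟨i₀, ConjAct.toConjAct g₀, fun a ha => ?_⟩
  rw [mem_conj_smul_iff₅, ConjAct.ofConjAct_toConjAct]
  exact mem_of_forall_characteristic_mem_sup hP htfg (hS i₀) fun U hUc hUo =>
    (Set.mem_iInter.mp hg₀ ⟨U, hUc, hUo⟩) a ha

/-- **Containment between conjugates of the family forces equality**, given that containment determines
the index: `γ • S i ≤ δ • S j ⇒ γ • S i = δ • S j` (`i = j` by hypothesis; then a closed subgroup of a
profinite group contained in a conjugate of itself is that conjugate,
`ProfiniteConjugateIndex.conj_smul_eq_self_of_ge`). [cite: MochizukiCombGC2007, Prop 1.2(i) p.8] -/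
theorem conj_eq_of_conj_le {ι : Type*} (S : ι → Subgroup P) (hS : ∀ i, IsClosed (S i : Set P))
    (hinc : ∀ (i j : ι) (γ δ : ConjAct P), γ • S i ≤ δ • S j → i = j)
    {i j : ι} {γ δ : ConjAct P} (h : γ • S i ≤ δ • S j) : γ • S i = δ • S j := by
  obtain rfl := hinc i j γ δ h
  have h1 : (δ⁻¹ * γ) • S i ≤ S i := by
    intro x hx
    rw [mul_smul, Subgroup.mem_inv_pointwise_smul_iff] at hx
    exact (Subgroup.smul_mem_pointwise_smul_iff).mp (h hx)
  have h2 : (δ⁻¹ * γ) • S i = S i := conj_smul_eq_self_of_ge (S i) (hS i) (δ⁻¹ * γ) h1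
  calc γ • S i = δ • ((δ⁻¹ * γ) • S i) := by rw [smul_smul, mul_inv_cancel_left]
    _ = δ • S i := by rw [h2]

/-- **The characterization of the conjugates of a finite family of closed, procyclic, infinite subgroups**
(abstract form of [IUTchI] Rmk. 1.2.3 (iv)/(v)).  Let `Π` be profinite, topologically finitely generated,
pro-`p`; `S` a finite family of closed, topologically procyclic, infinite subgroups such that containment
between conjugates determines the index; `R` a "ramification" predicate on pairs of subgroups such that
`R (A·U) U` at a characteristic open `U` puts `A` inside some `γ • S(i) · U`, and `R (γ•S(i)·U) U` always
holds.  Then `A` is a conjugate of a member of the family iff `A` satisfies `cond` (closed, procyclic,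
infinite, `R (A·U) U` for every characteristic open `U`) and is maximal among such subgroups.
[cite: Mochizuki2012, IUTchI Rmk 1.2.3(iv)-(v) pp.41-43] -/
theorem conj_family_characterization {ι : Type*} [Finite ι] (S : ι → Subgroup P)
    (hS : ∀ i, IsClosed (S i : Set P)) {p : ℕ} [Fact p.Prime]
    (hP : ∀ U : OpenNormalSubgroup P, IsPGroup p (P ⧸ (U : Subgroup P)))
    (htfg : IsTopologicallyFinitelyGenerated P)
    (hcyc : ∀ i, ∃ a : P, (Subgroup.zpowers a).topologicalClosure = S i)
    (hinf : ∀ i, (S i : Set P).Infinite)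
    (hinc : ∀ (i j : ι) (γ δ : ConjAct P), γ • S i ≤ δ • S j → i = j)
    (R : Subgroup P → Subgroup P → Prop)
    (hR₁ : ∀ (A U : Subgroup P), U.Characteristic → IsOpen (U : Set P) → R (A ⊔ U) U →
      ∃ (i : ι) (γ : ConjAct P), A ≤ γ • S i ⊔ U)
    (hR₂ : ∀ (i : ι) (γ : ConjAct P) (U : Subgroup P), U.Characteristic → IsOpen (U : Set P) →
      R (γ • S i ⊔ U) U)
    (A : Subgroup P) :
    (∃ (i : ι) (γ : ConjAct P), A = γ • S i) ↔
      ((IsClosed (A : Set P) ∧ (∃ a : P, (Subgroup.zpowers a).topologicalClosure = A) ∧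
          (A : Set P).Infinite ∧
          ∀ U : Subgroup P, U.Characteristic → IsOpen (U : Set P) → R (A ⊔ U) U) ∧
        ∀ B : Subgroup P,
          (IsClosed (B : Set P) ∧ (∃ b : P, (Subgroup.zpowers b).topologicalClosure = B) ∧
              (B : Set P).Infinite ∧
              ∀ U : Subgroup P, U.Characteristic → IsOpen (U : Set P) → R (B ⊔ U) U) →
            A ≤ B → A = B) := by
  -- (1) `cond` holds for every conjugate of a member of the family
  have hcond : ∀ (i : ι) (γ : ConjAct P),
      IsClosed ((γ • S i : Subgroup P) : Set P) ∧
        (∃ a : P, (Subgroup.zpowers a).topologicalClosure = γ • S i) ∧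
        ((γ • S i : Subgroup P) : Set P).Infinite ∧
        ∀ U : Subgroup P, U.Characteristic → IsOpen (U : Set P) → R (γ • S i ⊔ U) U := by
    intro i γ
    obtain ⟨a, ha⟩ := hcyc i
    exact ⟨isClosed_conj_smul₅ (hS i) γ, ⟨γ • a, by rw [← smul_topologicalClosure_zpowers₅, ha]⟩,
      infinite_conj_smul₅ (hinf i) γ, fun U hUc hUo => hR₂ i γ U hUc hUo⟩
  -- (2) the limit step: a `cond`-subgroup lies in a conjugate of a member of the family
  have hlim : ∀ B : Subgroup P,
      (∀ U : Subgroup P, U.Characteristic → IsOpen (U : Set P) → R (B ⊔ U) U) →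
        ∃ (j : ι) (g : ConjAct P), B ≤ g • S j := fun B hB =>
    exists_le_conj_of_forall_characteristic S hS hP htfg fun U hUc hUo =>
      hR₁ B U hUc hUo (hB U hUc hUo)
  constructor
  · rintro ⟨i, γ, rfl⟩
    refine ⟨hcond i γ, fun B hB hAB => ?_⟩
    -- (3) maximality
    obtain ⟨j, g, hBg⟩ := hlim B hB.2.2.2
    have heq : γ • S i = g • S j := conj_eq_of_conj_le S hS hinc (hAB.trans hBg)
    exact le_antisymm hAB (hBg.trans heq.symm.le)
  · rintro ⟨hA, hmax⟩
    -- (4) converse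
    obtain ⟨j, g, hAg⟩ := hlim A hA.2.2.2
    exact ⟨j, g, hmax _ (hcond j g) hAg⟩

end Family

end ConjFamily

end Literature.AnabelianGeometry.SemiGraphs

end

-- tree-health (abc-iut-w6-d081 g4, 2026-08-26T16:17Z): comment-only re-land of a STRANDED ACCEPT (accepted 15:13–15:14Z, farm import probe hangs «stale:unbuilt» at 16:0xZ, ≥ 50 min);
-- declarations byte-identical; rule of record: a re-land outside a reload window is served in 10–27 min (13/13 on 2026-08-26).
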